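import Mathlib
import Literature.AlgebraicGeometry.Resolution.FormalAxisOfNearChainGenerators
import Literature.AlgebraicGeometry.Resolution.OrderAlongFormalBranch
import HarnessLib

/-!
# Route `RadicialJung`, crux `CleanModels` (stmt-ResolutionOfSingularities-15917), line `Sketch` rev 35, stub 6 `stub_cleanProp44` (X44c),
# `τ = 1` residual, (B5″): THE FORMAL AXIS OF A STRAIGHTENED BIRTHS CHAIN LIES IN THE FORMAL LEAF, and is algebraic

Seat decomp-res-hand-2 g13 (structural hand).  Sequel of ✓ `…BirthAxis.lean` (`births_axis_exists_prime`: the two tree theorems of the non-clean T1 line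
composed) over the generators-exposed formal axis ✓ `Literature.….exists_prime_ne_maximalIdeal_map_le_pow_mem` (this seat, `FormalAxisOfNearChainGenerators.lean`).
In hand-2 g12's (B5″) argument (memo `Cruxes/CleanModels/Lines/Sketch-memo-hand2-g12-stubs-5-7.md` §4 (c)) the corrected pivots are `p`-TH-POWER
re-preparations of the leaf: `z₂⁽ᴺ⁾ = t + w · g_N^p` (`w = 1/v`, `g_N` the partial sums of the re-preparations, `g_0 = 0`), so the limit pivot is the FORMAL
LEAF `t̂ = t + w · ĝ^p`, `ĝ = lim g_N`.  This file records, in the kernel: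

* `adicLimit_add_mul_pow` — limits commute with the affine `p`-th-power expression: `lim (t + w g_N^p) = t + w (lim g_N)^p` in `R̂`
  (`adicLimit` of `FormalAxisOfNearChain.lean` is the algebra map `AdicCompletion.mkₐ` on Cauchy sequences).
* `births_axis_leaf` — **for a regular local G-ring `(R, 𝔪)` of dimension `3` with regular system of parameters `(u, t, u₂)`, a convergent sequence
  `g_N` (`g_0 = 0`), corrected parameters `z₂⁽ᴺ⁾ = t + w g_N^p`, `z₃⁽ᴺ⁾` (rates `𝔪^{N+2}`) and `J ⊆ (z₂⁽ᴺ⁾, z₃⁽ᴺ⁾)^μ + (u^{N+1})` for all `N`: there is a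
  formal prime `𝔓 ≠ 𝔪̂` of `R̂` with `J R̂ ⊆ 𝔓^μ`, `u ∉ 𝔓`, the FORMAL LEAF `t + w ĝ^p ∈ 𝔓` (`ĝ = lim g_N`), and below it the algebraic prime
  `𝔮 = 𝔓 ∩ R ≠ 𝔪` with `J R_𝔮 ⊆ (𝔮 R_𝔮)^μ`** — the axis is an algebraic `Σ_μ`-curve through `c` on whose formal branch `𝔓` the leaf class is
  represented by `t + w ĝ^p`; i.e. `−t/w` is a `p`-th power modulo `𝔓`.  The descent of that `p`-th power to `κ(𝔮)` / to the normalized branch is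
  ✓ `…PthPowerDescent(GRing).lean`; the strategy-order contradiction is dictionary business.

Honest framing: OURS; nothing here proves (B5″), the hypotheses of ✓ `cleanProp44_of_tauOneResidual`, X44c, any case of `CleanModels`, or resolution of
singularities in characteristic `p`. [cite: CossartPiltant2008, Prop. 4.4 (proof, p. 11)]
-/

set_option linter.dupNamespace false -- mandated namespace of this single-conjunct summit

noncomputable section

open IsLocalRing
open Literature.AlgebraicGeometry.Resolution

namespace Summit.ResolutionOfSingularities.ResolutionOfSingularities.Theorems.RadicialJung.CleanModels

universe u

section Limit

variable {R : Type u} [CommRing R] [IsLocalRing R]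

/-- `adicLimit` is the algebra map `mkₐ` on the Cauchy sequence (definitional). [folklore] -/
theorem mk_eq_mkₐ (x : AdicCompletion.AdicCauchySequence (maximalIdeal R) R) :
    AdicCompletion.mk (maximalIdeal R) R x = AdicCompletion.mkₐ (maximalIdeal R) x := rfl

/-- Two Cauchy sequences with `Z_n = t + w · G_n^p` termwise have `mkₐ Z = t + w · (mkₐ G)^p`. [folklore] -/
theorem mkₐ_eq_add_mul_pow (t w : R) (p : ℕ) (Z G : AdicCompletion.AdicCauchySequence (maximalIdeal R) R)
    (hZG : ∀ n, Z.val n = t + w * G.val n ^ p) :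
    AdicCompletion.mkₐ (maximalIdeal R) Z =
      algebraMap R _ t + algebraMap R _ w * AdicCompletion.mkₐ (maximalIdeal R) G ^ p := by
  have h : Z = algebraMap R _ t + algebraMap R _ w * G ^ p := by
    apply Subtype.ext
    funext n
    rw [hZG n]
    rfl
  rw [h, map_add, map_mul, map_pow, AlgHom.commutes, AlgHom.commutes]

/-- **Limits commute with `t + w · (−)^p`:** `lim (t + w g_N^p) = t + w (lim g_N)^p` in `R̂`. [folklore] -/
theorem adicLimit_add_mul_pow (t w : R) (p : ℕ) (g : ℕ → R) (hg : ∀ n, g (n + 1) - g n ∈ maximalIdeal R ^ n)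
    (hz : ∀ n, (t + w * g (n + 1) ^ p) - (t + w * g n ^ p) ∈ maximalIdeal R ^ n) :
    adicLimit (fun n => t + w * g n ^ p) hz =
      algebraMap R _ t + algebraMap R _ w * adicLimit g hg ^ p := by
  unfold adicLimit
  rw [mk_eq_mkₐ, mk_eq_mkₐ]
  exact mkₐ_eq_add_mul_pow t w p _ _ fun n => rfl

end Limit

/-- **The formal axis of a straightened births chain lies in the formal leaf, and is algebraic.**  See the module docstring.
[cite: CossartPiltant2008, Prop. 4.4 (proof, p. 11)] [cite: Matsumura1987, §32 p. 256] -/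
theorem births_axis_leaf {R : Type u} [CommRing R] [IsRegularLocalRing R] (hG : IsGRing R) (p : ℕ) (hp : 0 < p)
    (u t u₂ w : R) (hgen : Ideal.span {u, t, u₂} = maximalIdeal R) (hdim : ringKrullDim R = 3)
    (g : ℕ → R) (hg0 : g 0 = 0) (hg : ∀ n, g (n + 1) - g n ∈ maximalIdeal R ^ n)
    (hz₂ : ∀ n, (t + w * g (n + 1) ^ p) - (t + w * g n ^ p) ∈ maximalIdeal R ^ (n + 2))
    (z₃ : ℕ → R) (hz₃ : ∀ n, z₃ (n + 1) - z₃ n ∈ maximalIdeal R ^ (n + 2)) (h0₃ : z₃ 0 = u₂)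
    (J : Ideal R) (μ : ℕ)
    (hJ : ∀ N, J ≤ Ideal.span {t + w * g N ^ p, z₃ N} ^ μ ⊔ Ideal.span {u ^ (N + 1)}) :
    ∃ (𝔓 : Ideal (AdicCompletion (maximalIdeal R) R)) (_ : 𝔓.IsPrime),
      𝔓 ≠ maximalIdeal _ ∧
      J.map (algebraMap R (AdicCompletion (maximalIdeal R) R)) ≤ 𝔓 ^ μ ∧
      algebraMap R _ u ∉ 𝔓 ∧
      algebraMap R _ t + algebraMap R _ w * adicLimit g hg ^ p ∈ 𝔓 ∧
      𝔓.under R ≠ maximalIdeal R ∧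
      J.map (algebraMap R (Localization.AtPrime (𝔓.under R))) ≤ maximalIdeal (Localization.AtPrime (𝔓.under R)) ^ μ := by
  haveI : IsNoetherianRing R := inferInstance
  -- the corrected pivots `z₂⁽ᴺ⁾ = t + w g_N^p`
  have hz₂' : ∀ n, (t + w * g (n + 1) ^ p) - (t + w * g n ^ p) ∈ maximalIdeal R ^ n := fun n =>
    Ideal.pow_le_pow_right (by omega) (hz₂ n)
  have hz₃' : ∀ n, z₃ (n + 1) - z₃ n ∈ maximalIdeal R ^ n := fun n =>
    Ideal.pow_le_pow_right (by omega) (hz₃ n)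
  have h0₂ : (fun n => t + w * g n ^ p) 0 = t := by
    simp [hg0, zero_pow hp.ne']
  obtain ⟨𝔓, hprime, hne, hJle, hmem₂, -, hu, -⟩ :=
    exists_prime_ne_maximalIdeal_map_le_pow_mem u t u₂ hgen hdim (fun n => t + w * g n ^ p) z₃ hz₂ hz₃ hz₂' hz₃'
      h0₂ h0₃ J μ hJ
  haveI := hprime
  rw [adicLimit_add_mul_pow t w p g hg hz₂'] at hmem₂
  refine ⟨𝔓, hprime, hne, hJle, hu, hmem₂, ?_, map_le_pow_maximalIdeal_localization_under hG J μ 𝔓 hJle⟩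
  -- `𝔓 ∩ R ≠ 𝔪`: otherwise `𝔪̂ = 𝔪 R̂ ⊆ 𝔓`, forcing `𝔓 = 𝔪̂`
  intro h
  apply hne
  have hmap : (𝔓.under R).map (algebraMap R (AdicCompletion (maximalIdeal R) R)) ≤ 𝔓 := Ideal.map_comap_le
  rw [h, ← AdicCompletion.maximalIdeal_eq_map] at hmap
  exact ((IsLocalRing.maximalIdeal.isMaximal _).eq_of_le hprime.ne_top hmap).symm

end Summit.ResolutionOfSingularities.ResolutionOfSingularities.Theorems.RadicialJung.CleanModels

end
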